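import Summits.QuantumFields.YangMills.Theorems.UnitScaleTiltProp7OneFormGreenBlockDivergenceKFree
import Summits.QuantumFields.YangMills.Theorems.UnitScaleTiltProp7OneFormCoerciveHolds
import Summits.QuantumFields.YangMills.Theorems.UnitScaleTiltProp7KernelRow349AllMembers
import Summits.QuantumFields.YangMills.Theorems.UnitScaleTiltProp7LiftOfRSEqPrintProjector
import HarnessLib

/-!
# Route `UnitScaleTilt`, crux K1 «MinimiserStabilityRegPr» (stmt-QuantumFields-19200), EX face, norm_G ∕ h133 road — N6 FILE D letter (dκ), FAMILY EDITION:
# **THE DECAYED COVARIANT-DIVERGENCE ROW OF `G₀` ON A BLOCK-SUPPORTED SOURCE FOR ALL MEMBERS WITH ROOM, L-ONLY CONSTANTS** — the (Db) letter of ★p1 g27's D3 as an `∃`-package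
# over (γ) ✓`hco_DeltaEtaSlot_exists` + hk_D ✓`kernelRow349_allMembers_exists` and the member theorem ✓`divergence_GT_DeltaEtaSlot_kfree`; token-for-token the twin of px16 ✓p770245
# `blockColumn_GT_DeltaEtaSlot_family` (same packages, same `ε(L)`, `r(L)`; the cap `αG` takes ONE more `min` = the K-free gradient margin of T1-κ), with the member's no-wrap room DISPLAYED.
# (width seat `ym3-torus-px21` g15; ★p1 g27 CHAIR WORD №32 «suppliers, say if your family edition exists».)

Cell `ym3-torus` (HUMAN RULING D-0037; rung R3 = SU(2) YM₃ on T³ — NOT d = 4, NOT infinite volume, NOT a mass gap, NOT Clay).  THEOREMS ONLY (0 `def`, 0 `sorry`);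
`--supports stmt-QuantumFields-19200 --as helper`; count-neutral.

WHAT.  ★★★ `divergence_GT_DeltaEtaSlot_family`: for L-only weights `c₀ cB : ℕ → ℝ` (positive) and a coupling window `0 < a₀ ≤ a₁`, THERE ARE L-only `αG CD δG : ℕ → ℝ` (cap with the three
windows of record, constant `≥ 0`, rate `> 0`) such that for every `L > 1`, member `i : Idx L`, background `U₀` with `RegPr ρ U₀`, `ρ ≤ αG L`, under `Lift`, every coupling
`a₀(c₀ L∕cB L)ℓ³ ≤ a ≤ a₁(c₀ L∕cB L)ℓ³`, AND THE MEMBER'S NO-WRAP ROOM `2(12ℓ + 5) ≤ sitesPerDir 0` (displayed — the T1-lineage letter; small members go through the cover road,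
CHAIR WORD №1 class, as ✓`Prop7KernelRow349OfCover` does for `h349`): the (Db) TEXT `∀ X z, (∀ b, X b ≠ 0 → B b₋ = z) → ∀ s ≥ 0, (∀ b, ‖X b‖ ≤ s) → ∀ x,
‖toL2S⁻¹(D*_{U₀}(G₀(toL2 X))) x‖ ≤ s·CD L·e^{−δG L·tdist(B x, z)}`, `G₀ = GT … a (DeltaEtaSlot …) U₀`.
PROOF.  (γ) ⟸ ✓`hco_DeltaEtaSlot_exists` (`αco γco`); hk_D ⟸ px10 ✓`kernelRow349_allMembers_exists` (`αK CK δK`, `C_K·ℓ⁻³`, `projR`-text) read in `R_S`-text under `Lift` via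
✓`exists_intertwiner_of_regPr` + ✓`RS_eq_projR_iff_lift`; then ✓`divergence_GT_DeltaEtaSlot_kfree` at px16's L-only choices `ε L := min ⅛ (γco L∕(8C_V¹))`,
`r L := min (min ¼ (δK L∕2)) (min (γco L·ε L∕48) (γco L∕(16(T L + 1))))`, `δG L := min (r L) ¼ ∕ 2`, and the cap
`αG L := min (min (min (αco L) (αK L)) (min (10¹⁰L⁶)⁻¹ (γco L∕(16·10⁵)))) (2·C_g·(48(6√2√10+6√2))·e^{51∕8} + 1)⁻¹` — the last `min` IS the gradient margin (`x∕(2x+1) ≤ ½`).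
HEARTBEATS (README rule, disclosed): the theorem carries a decl-local `set_option maxHeartbeats 400000 in` — measured: fails at 100 000, passes at 150 000 and at the 200 000 default
(the printed L-only constant is 4 kchar); budgeted ×2.6 against the CI cliff; the mathematics is unaffected.
HONEST SCOPE.  An `∃`-package; constants EXISTENTIAL-but-L-only; CONDITIONAL on nothing displayed beyond `RegPr`∕cap∕`Lift`∕coupling window∕ROOM; nothing of `h133`, `norm_G`, the EX rows,
EX or the crux is proved — this is the (Db) input to D3's family knit, no more; no summit is proved by a helper.

References: T. Bałaban, CMP **99** (1985) 389–434 [Balaban1985BackgroundPropagators] ((3.8) p.392, Thm 3.1 (3.42)–(3.47) pp.397–399, (3.49) p.399, Thm 3.11 p.416, Thm 3.12 p.422);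
CMP **102** (1985) 277–309 [Balaban1985Variational] (Thm 1 p.279, the `L`-only constants).
-/

set_option autoImplicit false

noncomputable section

open scoped Matrix.Norms.L2Operator BigOperators InnerProductSpace ComplexConjugate

namespace Summit.QuantumFields.YangMills.Theorems.Prop7OneFormGreenBlockDivergenceFamily

open Literature.MathematicalPhysics.QuantumFieldTheory.Balaban1983to89
open Literature.MathematicalPhysics.QuantumFieldTheory.Balaban1983to89.T3ContinuumYM3Torus
open Literature.MathematicalPhysics.QuantumFieldTheory.Balaban1983to89.T3PrintedRegularMinimiser (RegPr)
open Literature.MathematicalPhysics.QuantumFieldTheory.Balaban1983to89.T3PrintedMinimiserExistence (regPr_mono)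
open B15DeterminingSets (embIter)
open T3SectALandauChart (formComp bgUnits eta eta_pos)
open B9SectCLatticeCarrier (Bond)
open B9Eq311L2Pairing (WL2)
open B11Eq103H1Complex (BondL2K projR)
open B5Eq118OneStroke (iterBlockOf)
open Summit.QuantumFields.YangMills.Theorems.Prop8Chart (emlIterU)
open Summit.QuantumFields.YangMills.Theorems.Prop7SectET3Transport (periodsT3 bondEquiv)
open Summit.QuantumFields.YangMills.Theorems.Prop7SectET3HilbertLetters (W₂ frobEquiv toL2 toL2S DL2 DstarL2 covLapSite)
open Summit.QuantumFields.YangMills.Theorems.Prop7SectET3WilsonHessian (DeltaEtaSlot)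
open Summit.QuantumFields.YangMills.Theorems.Prop7SectET3GaugeProjector (RS)
open Summit.QuantumFields.YangMills.Theorems.Prop7SectET3CurvedPropagators (laplaceA Qk GT PosOnto)
open Summit.QuantumFields.YangMills.Theorems.Prop7OneFormCoerciveHolds (hco_DeltaEtaSlot_exists)
open Summit.QuantumFields.YangMills.Theorems.Prop7KernelRow349AllMembers (kernelRow349_allMembers_exists)
open Summit.QuantumFields.YangMills.Theorems.Prop7LiftOfRSEqPrintProjector (RS_eq_projR_iff_lift)
open Summit.QuantumFields.YangMills.Theorems.Prop7NSIntertwinerOfRecord (exists_intertwiner_of_regPr)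
open Summit.QuantumFields.YangMills.Theorems.Prop7OneFormGreenBlockDivergenceKFree (divergence_GT_DeltaEtaSlot_kfree)
open Summit.QuantumFields.YangMills.Theorems.Prop7CurvedMemberLocalGradient (exists_curved_localGradient)
open Summit.QuantumFields.YangMills.Theorems.AxialGaugeChartGlue (norm_bgOfCfg_axialT_sub_le)

set_option maxHeartbeats 400000 in
/-- ★★★ **THE (Db) FAMILY: DECAYED COVARIANT-DIVERGENCE ROW OF `G₀` ON A BLOCK-SUPPORTED SOURCE FOR ALL MEMBERS WITH ROOM, L-ONLY CONSTANTS.**  For positive L-only weights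
`c₀ cB` and a coupling window `0 < a₀ ≤ a₁` there are `αG CD δG : ℕ → ℝ` with `0 < αG L`, `10¹²L³αG L ≤ 1`, `10¹⁰L⁶αG L ≤ 1`, `13·10¹⁴L³αG L ≤ 1`, `0 ≤ CD L`, `0 < δG L`, and: for every
`L > 1`, member `i : Idx L`, background `U₀` with `RegPr ρ U₀`, `ρ ≤ αG L`, under `Lift`, coupling `a₀(c₀ L∕cB L)ℓ³ ≤ a ≤ a₁(c₀ L∕cB L)ℓ³`, and the no-wrap room `2(12ℓ+5) ≤ sitesPerDir 0`:
`∀ X z, (∀ b, X b ≠ 0 → B b₋ = z) → ∀ s ≥ 0, (∀ b, ‖X b‖ ≤ s) → ∀ x, ‖toL2S⁻¹(D*_{U₀}(G₀(toL2 X))) x‖ ≤ s·CD L·e^{−δG L·tdist(B x, z)}` (print's (3.42)₂ `‖G∇*‖`-class row of `G₀`,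
decayed, uniform in `K`). [cite: Balaban1985BackgroundPropagators, Thm 3.1 (3.42)–(3.44) pp.397–398, (3.49) p.399, Thm 3.11 p.416, Thm 3.12 p.422; Balaban1985Variational, Thm 1 p.279] -/
theorem divergence_GT_DeltaEtaSlot_family (c₀ cB : ℕ → ℝ) [hc₀ : ∀ L : ℕ, Fact (0 < c₀ L)] [hcB : ∀ L : ℕ, Fact (0 < cB L)] {a₀ a₁ : ℝ} (ha₀ : 0 < a₀) (ha₀₁ : a₀ ≤ a₁) :
    ∃ (αG CD δG : ℕ → ℝ),
      (∀ L : ℕ, 1 < L → 0 < αG L) ∧ (∀ L : ℕ, 1 < L → 10 ^ 12 * (L : ℝ) ^ 3 * αG L ≤ 1) ∧ (∀ L : ℕ, 1 < L → 10 ^ 10 * (L : ℝ) ^ 6 * αG L ≤ 1) ∧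
      (∀ L : ℕ, 1 < L → 13 * 10 ^ 14 * (L : ℝ) ^ 3 * αG L ≤ 1) ∧ (∀ L : ℕ, 1 < L → 0 ≤ CD L) ∧ (∀ L : ℕ, 1 < L → 0 < δG L) ∧
    ∀ (L : ℕ), 1 < L → ∀ (i : T3Thm1Carrier.Idx L) (U₀ : GaugeField (i.1.1.P i.1.2.2) 0 (Matrix.specialUnitaryGroup (Fin 2) ℂ)), ∀ ρ : ℝ, RegPr i.1.1 i.1.2.1 i.1.2.2 ρ U₀ → ρ ≤ αG L →
        (∀ cf : Site (i.1.1.P i.1.2.2) (i.1.2.2 - i.1.2.1) → Matrix (Fin 2) (Fin 2) ℂ,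
        (∀ e' : PBond (i.1.1.P i.1.2.2) (i.1.2.2 - i.1.2.1), cf e'.src = ((emlIterU (i.1.2.2 - i.1.2.1) (bgUnits i.1.1 i.1.2.2 U₀) e' : (Matrix (Fin 2) (Fin 2) ℂ)ˣ) : Matrix (Fin 2) (Fin 2) ℂ) * cf e'.tgt *
        (((emlIterU (i.1.2.2 - i.1.2.1) (bgUnits i.1.1 i.1.2.2 U₀) e')⁻¹ : (Matrix (Fin 2) (Fin 2) ℂ)ˣ) : Matrix (Fin 2) (Fin 2) ℂ)) →
        ∃ l₀ : Site (i.1.1.P i.1.2.2) 0 → Matrix (Fin 2) (Fin 2) ℂ,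
        (∀ b' : PBond (i.1.1.P i.1.2.2) 0, l₀ b'.src = ((bgUnits i.1.1 i.1.2.2 U₀ b' : (Matrix (Fin 2) (Fin 2) ℂ)ˣ) : Matrix (Fin 2) (Fin 2) ℂ) * l₀ b'.tgt * (((bgUnits i.1.1 i.1.2.2 U₀ b')⁻¹ : (Matrix (Fin 2) (Fin 2) ℂ)ˣ) : Matrix (Fin 2) (Fin 2) ℂ)) ∧
        ∀ y : Site (i.1.1.P i.1.2.2) (i.1.2.2 - i.1.2.1), l₀ (embIter (i.1.2.2 - i.1.2.1) y) = cf y) →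
      ∀ a : ℝ, a₀ * (c₀ L / cB L) * ((i.1.1.L : ℝ) ^ (i.1.2.2 - i.1.2.1)) ^ 3 ≤ a → a ≤ a₁ * (c₀ L / cB L) * ((i.1.1.L : ℝ) ^ (i.1.2.2 - i.1.2.1)) ^ 3 →
      2 * (12 * i.1.1.L ^ (i.1.2.2 - i.1.2.1) + 5) ≤ (i.1.1.P i.1.2.2).sitesPerDir 0 →
      ∀ (X : PBond (i.1.1.P i.1.2.2) 0 → Matrix (Fin 2) (Fin 2) ℂ) (z : Site (i.1.1.P i.1.2.2) (i.1.2.2 - i.1.2.1)),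
        (∀ b, X b ≠ 0 → iterBlockOf (i.1.2.2 - i.1.2.1) b.src = z) → ∀ s : ℝ, 0 ≤ s → (∀ b, ‖X b‖ ≤ s) →
        ∀ x : Site (i.1.1.P i.1.2.2) 0,
          ‖(toL2S i.1.1 i.1.2.2 (c₀ L)).symm (DstarL2 i.1.1 i.1.2.1 i.1.2.2 (c₀ L) U₀ (GT i.1.1 i.1.2.1 i.1.2.2 i.2.2.le (c₀ L) (cB L) a
              (DeltaEtaSlot i.1.1 i.1.2.1 i.1.2.2 (c₀ L)) U₀ (toL2 i.1.1 i.1.2.2 (c₀ L) X))) x‖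
          ≤ s * CD L * Real.exp (-(δG L * (Site.tdist (P := i.1.1.P i.1.2.2) (iterBlockOf (i.1.2.2 - i.1.2.1) x) z : ℝ))) := by
  obtain ⟨αco, γco, hαco, hWco, hwinco, hγco, hco⟩ := hco_DeltaEtaSlot_exists c₀ cB ha₀
  obtain ⟨αK, CK, δK, hαK, hWK, hCK, hδK, hkD⟩ := kernelRow349_allMembers_exists c₀ cB
  -- the L-only choices
  set CV1 : ℝ := 32 * Real.sqrt 2 * 648 + (33 / 8 : ℝ) ^ 2 * (600 * (27 / 4 : ℝ) ^ 6) with hCV1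
  have hCV1pos : 0 < CV1 := by rw [hCV1]; positivity
  have ha₁ : 0 ≤ a₁ := le_trans ha₀.le ha₀₁
  set T : ℕ → ℝ := fun L => 5000 * a₁ + 27 * Real.sqrt 2 * CK L * (2 * (1 + 4 / δK L)) ^ 3 / min 1 (δK L / 4) with hT
  set ε : ℕ → ℝ := fun L => min (1 / 8) (γco L / (8 * CV1)) with hε
  set r : ℕ → ℝ := fun L => min (min (1 / 4) (δK L / 2)) (min (γco L * ε L / 48) (γco L / (16 * (T L + 1)))) with hr
  set Mg : ℝ := exists_curved_localGradient.choose * (48 * (6 * Real.sqrt 2 * Real.sqrt 10 + 6 * Real.sqrt 2)) * Real.exp (51 / 8) with hMg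
  have hMg0 : 0 ≤ Mg := by have := exists_curved_localGradient.choose_spec.1; rw [hMg]; positivity
  set αG : ℕ → ℝ := fun L => min (min (min (αco L) (αK L)) (min ((10 ^ 10 * (L : ℝ) ^ 6)⁻¹) (γco L / (16 * 10 ^ 5)))) (2 * Mg + 1)⁻¹ with hαG
  have hT0 : ∀ L, 1 < L → 0 ≤ T L := fun L hL => by
    have := hCK L hL; have := hδK L hL
    simp only [hT]; positivity
  have hε0 : ∀ L, 1 < L → 0 < ε L := fun L hL => by
    have := hγco L hL; simp only [hε]; exact lt_min (by norm_num) (by positivity)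
  have hr0 : ∀ L, 1 < L → 0 < r L := fun L hL => by
    have := hγco L hL; have := hδK L hL; have := hε0 L hL; have := hT0 L hL
    simp only [hr]; exact lt_min (lt_min (by norm_num) (by positivity)) (lt_min (by positivity) (by positivity))
  have hαG0 : ∀ L, 1 < L → 0 < αG L := fun L hL => by
    have := hγco L hL; have := hαco L hL; have := hαK L hL
    have hL0 : (0 : ℝ) < L := by exact_mod_cast lt_trans zero_lt_one hL
    simp only [hαG]; exact lt_min (lt_min (lt_min (by assumption) (by assumption)) (lt_min (by positivity) (by positivity))) (by positivity)
  refine ⟨αG,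
    fun L => (3 * (Real.exp (4 / 8) * (2 * ((exists_curved_localGradient.choose * (((Real.sqrt 2 * (2 * ((Real.sqrt 2 + Real.sqrt 2 * ((50 * a₁ * Real.exp (δK L) + CK L) * (3 * Real.sqrt 2) * (Real.exp (6 * r L) * (2 / γco L)) * (2 * (1 + 2 / δK L)) ^ 3)) * (8 * Real.exp (3 * r L)) * 14 + 36 * (Real.sqrt (8 * Real.exp (3 * r L) * (2 * (1 + 1 / r L)) ^ 3) * (Real.exp (6 * r L) * (2 / γco L)))))) * Real.exp (51 / 8)) * (2 + 2 * Real.sqrt 2 * (4 * αG L * (3 + 2457 * norm_bgOfCfg_axialT_sub_le.choose)) + (24 * Real.sqrt 10 + 48) * (48 * αG L) ^ 2) + (Real.sqrt 2 * ((32 * αG L * ((2 * ((Real.sqrt 2 + Real.sqrt 2 * ((50 * a₁ * Real.exp (δK L) + CK L) * (3 * Real.sqrt 2) * (Real.exp (6 * r L) * (2 / γco L)) * (2 * (1 + 2 / δK L)) ^ 3)) * (8 * Real.exp (3 * r L)) * 14 + 36 * (Real.sqrt (8 * Real.exp (3 * r L) * (2 * (1 + 1 / r L)) ^ 3) * (Real.exp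 (6 * r L) * (2 / γco L))))) * Real.exp (5 / 8))) + (CK L * (3 * Real.sqrt 2) * (Real.exp (6 * r L) * (2 / γco L)) * (2 * (1 + 2 / δK L)) ^ 3) + ((50 * a₁ * Real.exp (δK L)) * (3 * Real.sqrt 2) * (Real.exp (6 * r L) * (2 / γco L)) * (2 * (1 + 2 / δK L)) ^ 3) + 1)) * Real.exp (51 / 8)) + 2 * Real.sqrt 2 * (48 * αG L) * ((Real.sqrt 2 * (2 * ((Real.sqrt 2 + Real.sqrt 2 * ((50 * a₁ * Real.exp (δK L) + CK L) * (3 * Real.sqrt 2) * (Real.exp (6 * r L) * (2 / γco L)) * (2 * (1 + 2 / δK L)) ^ 3)) * (8 * Real.exp (3 * r L)) * 14 + 36 * (Real.sqrt (8 * Real.exp (3 * r L) * (2 * (1 + 1 / r L)) ^ 3) * (Real.exp (6 * r L) * (2 / γco L)))))) * Real.exp (51 / 8))))))),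
    fun L => min (r L) (1 / 4) / 2, hαG0, fun L hL => ?_, fun L hL => ?_, fun L hL => ?_, fun L hL => ?_, fun L hL => ?_, ?_⟩
  · -- window `10¹²L³`
    have h1 : αG L ≤ αco L := by simp only [hαG]; exact ((min_le_left _ _).trans (min_le_left _ _)).trans (min_le_left _ _)
    have hL0 : (0 : ℝ) < L := by exact_mod_cast lt_trans zero_lt_one hL
    exact (mul_le_mul_of_nonneg_left h1 (by positivity)).trans (hWco L hL)
  · -- window `10¹⁰L⁶`
    have hL0 : (0 : ℝ) < L := by exact_mod_cast lt_trans zero_lt_one hL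
    have h1 : αG L ≤ (10 ^ 10 * (L : ℝ) ^ 6)⁻¹ := by simp only [hαG]; exact ((min_le_left _ _).trans (min_le_right _ _)).trans (min_le_left _ _)
    calc 10 ^ 10 * (L : ℝ) ^ 6 * αG L ≤ 10 ^ 10 * (L : ℝ) ^ 6 * (10 ^ 10 * (L : ℝ) ^ 6)⁻¹ := mul_le_mul_of_nonneg_left h1 (by positivity)
      _ = 1 := mul_inv_cancel₀ (by positivity)
  · -- window `13·10¹⁴L³`
    have h1 : αG L ≤ αco L := by simp only [hαG]; exact ((min_le_left _ _).trans (min_le_left _ _)).trans (min_le_left _ _)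
    have hL0 : (0 : ℝ) < L := by exact_mod_cast lt_trans zero_lt_one hL
    exact (mul_le_mul_of_nonneg_left h1 (by positivity)).trans (hwinco L hL)
  · -- `0 ≤ CD L`
    have := hγco L hL; have := hCK L hL; have := hδK L hL; have := hr0 L hL; have := hαG0 L hL
    have := exists_curved_localGradient.choose_spec.1; have := norm_bgOfCfg_axialT_sub_le.choose_spec.1
    positivity
  · -- `0 < δG L`
    have := hr0 L hL
    exact div_pos (lt_min this (by norm_num)) two_pos
  -- the member
  intro L hL i U₀ ρ hreg hρ hlift a ha₀a ha₁a hroom X z hXz s hs hX x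
  have hγ := hγco L hL
  have hCKL := hCK L hL
  have hδKL := hδK L hL
  have hεL := hε0 L hL
  have hrL := hr0 L hL
  have hTL := hT0 L hL
  have hαL := hαG0 L hL
  have hc₀L : 0 < c₀ L := (hc₀ L).out
  have hcBL : 0 < cB L := (hcB L).out
  have hL0 : (0 : ℝ) < L := by exact_mod_cast lt_trans zero_lt_one hL
  have hLL : (L : ℝ) = (i.1.1.L : ℝ) := by rw [i.2.1]
  -- the cap and its windows at this member (`F.L = L`)
  have hαco' : αG L ≤ αco L := by simp only [hαG]; exact ((min_le_left _ _).trans (min_le_left _ _)).trans (min_le_left _ _)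
  have hαK' : αG L ≤ αK L := by simp only [hαG]; exact ((min_le_left _ _).trans (min_le_left _ _)).trans (min_le_right _ _)
  have hαγ' : αG L ≤ γco L / (16 * 10 ^ 5) := by simp only [hαG]; exact ((min_le_left _ _).trans (min_le_right _ _)).trans (min_le_right _ _)
  have hαM' : αG L ≤ (2 * Mg + 1)⁻¹ := by simp only [hαG]; exact min_le_right _ _
  have hW1 : 10 ^ 12 * (i.1.1.L : ℝ) ^ 3 * αG L ≤ 1 := by
    rw [← hLL]; exact (mul_le_mul_of_nonneg_left hαco' (by positivity)).trans (hWco L hL)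
  have hW2 : 10 ^ 10 * (i.1.1.L : ℝ) ^ 6 * αG L ≤ 1 := by
    rw [← hLL]
    have h1 : αG L ≤ (10 ^ 10 * (L : ℝ) ^ 6)⁻¹ := by simp only [hαG]; exact ((min_le_left _ _).trans (min_le_right _ _)).trans (min_le_left _ _)
    calc 10 ^ 10 * (L : ℝ) ^ 6 * αG L ≤ 10 ^ 10 * (L : ℝ) ^ 6 * (10 ^ 10 * (L : ℝ) ^ 6)⁻¹ := mul_le_mul_of_nonneg_left h1 (by positivity)
      _ = 1 := mul_inv_cancel₀ (by positivity)
  have hW3 : 13 * 10 ^ 14 * (i.1.1.L : ℝ) ^ 3 * αG L ≤ 1 := by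
    rw [← hLL]; exact (mul_le_mul_of_nonneg_left hαco' (by positivity)).trans (hwinco L hL)
  have hregG : RegPr i.1.1 i.1.2.1 i.1.2.2 (αG L) U₀ := regPr_mono i.1.1 hρ hreg
  have hregK : RegPr i.1.1 i.1.2.1 i.1.2.2 (αK L) U₀ := regPr_mono i.1.1 (hρ.trans hαK') hreg
  -- (γ) at this member
  have hco' := hco L hL i U₀ ρ hreg (hρ.trans hαco') hlift a ha₀a
  -- hk_D at this member, in `R_S`-text under `Lift`
  obtain ⟨Q'', D', hint, hD', htop, hseq, hker⟩ :=
    exists_intertwiner_of_regPr i.1.1 i.2.2.le (c₀ := c₀ L) (cB L) hαL hW1 U₀ hregG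
  have hRS : RS i.1.1 i.1.2.1 i.1.2.2 i.2.2.le (c₀ L) (cB L) U₀ = projR (covLapSite i.1.1 i.1.2.1 i.1.2.2 (c₀ L) U₀) Q'' :=
    (RS_eq_projR_iff_lift i.1.1 i.2.2.le (cB L) hαL hW1 U₀ hregG Q'' htop hker).2 hlift
  have hkD' := hkD L hL i U₀ hregK Q'' htop hker
  rw [← hRS, hLL] at hkD'
  -- the coupling window gives `0 ≤ a`
  have ha : 0 ≤ a := le_trans (by positivity) ha₀a
  -- the budgets
  have hε8 : ε L ≤ 1 / 8 := by simp only [hε]; exact min_le_left _ _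
  have hεC : ε L * CV1 ≤ γco L / 8 := by
    have h1 : ε L ≤ γco L / (8 * CV1) := by simp only [hε]; exact min_le_right _ _
    calc ε L * CV1 ≤ γco L / (8 * CV1) * CV1 := mul_le_mul_of_nonneg_right h1 hCV1pos.le
      _ = γco L / 8 := by field_simp
  have hr4 : r L ≤ 1 / 4 := by simp only [hr]; exact (min_le_left _ _).trans (min_le_left _ _)
  have hrδ : r L ≤ δK L / 2 := by simp only [hr]; exact (min_le_left _ _).trans (min_le_right _ _)
  have hrγ : r L ≤ γco L * ε L / 48 := by simp only [hr]; exact (min_le_right _ _).trans (min_le_left _ _)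
  have hrT : r L * T L ≤ γco L / 16 := by
    have h1 : r L ≤ γco L / (16 * (T L + 1)) := by simp only [hr]; exact (min_le_right _ _).trans (min_le_right _ _)
    calc r L * T L ≤ r L * (T L + 1) := mul_le_mul_of_nonneg_left (by linarith) hrL.le
      _ ≤ γco L / (16 * (T L + 1)) * (T L + 1) := mul_le_mul_of_nonneg_right h1 (by linarith)
      _ = γco L / 16 := by field_simp
  have hαγ : 10 ^ 5 * αG L ≤ γco L / 16 := by
    calc 10 ^ 5 * αG L ≤ 10 ^ 5 * (γco L / (16 * 10 ^ 5)) := mul_le_mul_of_nonneg_left hαγ' (by positivity)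
      _ = γco L / 16 := by field_simp
  -- the gradient margin from the cap: `C_g·(48αG·M)·e^{51∕8} = αG·Mg ≤ Mg∕(2Mg+1) ≤ ½`
  have hsmall : exists_curved_localGradient.choose * ((48 * αG L) * (6 * Real.sqrt 2 * Real.sqrt 10 + 6 * Real.sqrt 2)) * Real.exp (51 / 8) ≤ 1 / 2 := by
    have e : exists_curved_localGradient.choose * ((48 * αG L) * (6 * Real.sqrt 2 * Real.sqrt 10 + 6 * Real.sqrt 2)) * Real.exp (51 / 8) = αG L * Mg := by
      rw [hMg]; ring
    rw [e]
    have h1 : αG L * Mg ≤ (2 * Mg + 1)⁻¹ * Mg := mul_le_mul_of_nonneg_right hαM' hMg0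
    have h2 : (2 * Mg + 1)⁻¹ * Mg ≤ 1 / 2 := by
      rw [inv_mul_le_iff₀ (by positivity)]; linarith
    exact h1.trans h2
  have hmain := divergence_GT_DeltaEtaSlot_kfree i.1.1 i.2.2.le (c₀ L) (cB L) i.2.2 hαL hW1 hW2 hW3 U₀ hregG hlift ha ha₁a hγ hco' hCKL hδKL hkD'
    hrL hr4 hrδ hεL hε8 hεC hrγ (by simp only [hT] at hrT; exact hrT) hαγ hroom hsmall X z hXz s hs hX x
  exact hmain

end Summit.QuantumFields.YangMills.Theorems.Prop7OneFormGreenBlockDivergenceFamily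

end
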